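import Mathlib
import HarnessLib

/-!
# `Balaban1983to89.B10Eq11Trace` — the identity behind **(11)** of T. Bałaban, *Ultraviolet stability of
three-dimensional lattice pure gauge field theories*, Commun. Math. Phys. **102**, 255–275 (1985) [Balaban1985UV3]

(Cell numbering B10; journal page = PDF page + 254; read from the page render
`run/shared/lean/pub/pub-balaban/b2b-balaban-ref1/pages/1985-cmp102-uv-stability-3d/1985-cmp102-uv-stability-3d-p004-x2.png`
(p. 258), re-read 2026-08-20 for this file.)

HONEST FRAMING (mega-formalization `lit-balaban`, verbatim): statement-level skeleton of published theorems with
citation tags; proofs where landed; nothing here is a claim about the Yang–Mills mass gap.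

WHY THIS FILE EXISTS.  Unit `lit-balaban-r07` (reader/typer of B10), gen 2.  Display (11) p. 258 [4] reads, verbatim:
*"For each plaquette p ∈ P, where P is one of the sets occurring in the definition of ζ_{Ω₁ᶜ}, we have
exp[−(1/g₀²)[1 − Re tr U(∂p)]] = exp[−(1/2g₀²)|U(∂p) − 1|²] ≤ exp(−½p²(g₀)), (11) and by the definition of
g₀ = gε^{1/2} the number on the right-hand side is smaller than any positive power of ε."*  The cell module `…B10`
kernel-checks the INEQUALITY and the last clause (`B10.smallFactor_le_pow`) and records that the middle EQUALITY
`1 − Re tr U(∂p) = ½|U(∂p) − 1|²` *"presupposes tr = normalised trace and |·| = normalised Hilbert–Schmidt norm — cell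
DIVERGENCE D-b10.1; with the operator norm one only has 1 − Re tr U ≥ (2 dim)⁻¹|U − 1|²"* (docstring of
`B10.smallFactor_le_pow`); SKELETON row B10.Eq11 carried the equality as "identity = convention of the series".
This file kernel-checks that identity for unitary matrices in the reading under which it is exact:

* `re_trace_defect_eq` — for `U ∈ U(N)`: `Re Tr((U − 1)ᴴ(U − 1)) = 2(N − Re Tr U)` (from `(U − 1)ᴴ(U − 1) =
  2·1 − U − Uᴴ`, `conjTranspose_sub_one_mul_self`);
* `eq11_normalized` — dividing by `N`: `1 − Re tr U = ½|U − 1|²` with `tr = N⁻¹Tr` (the normalized trace of the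
  series, `Setup.GaugeGroup.reTr`, `tr 1 = 1`) and `|A|² = N⁻¹ Σ_{ij}|A_{ij}|²` (normalized Hilbert–Schmidt norm).

v1.1 (append-only, section `OperatorNorm`): the operator-norm reading of `|U(∂p) − 1|` ([Balaban1985Averaging] (19);
`Setup.GaugeGroup.dist1`), under which (11)'s middle member is only the inequality
`1 − Re tr U ≥ (2N)⁻¹|U − 1|²_op` with the dimension-dependent constant recorded in `…B10` — kernel-checked as
`eq11_opNorm_vector` (vector form) and `eq11_opNorm` (Mathlib's scoped `L2Operator` matrix norm).  Nothing else of
the series is touched.  Value = SKELETON row B10.Eq11 of `HOME/SKELETON.md` §B10 gains a kernel-checked middle member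
in both readings; NOT summit progress.
-/

namespace Literature.MathematicalPhysics.QuantumFieldTheory.Balaban1983to89.B10Eq11Trace

open Matrix

variable {n : Type*} [Fintype n] [DecidableEq n]

/-- Matrix algebra behind the middle equality of **(11)** p. 258 [4]: for a unitary matrix `U` (`UᴴU = 1`),
`(U − 1)ᴴ(U − 1) = 2·1 − U − Uᴴ`. [cite: Balaban1985UV3, (11) p.258] -/
theorem conjTranspose_sub_one_mul_self (U : Matrix n n ℂ) (hU : U ∈ Matrix.unitaryGroup n ℂ) :
    (U - 1)ᴴ * (U - 1) = (2 : ℂ) • (1 : Matrix n n ℂ) - U - Uᴴ := by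
  have h : Uᴴ * U = 1 := by
    have h' := Matrix.mem_unitaryGroup_iff'.mp hU
    rwa [Matrix.star_eq_conjTranspose] at h'
  rw [conjTranspose_sub, conjTranspose_one, sub_mul, one_mul, mul_sub, mul_one, h, two_smul]
  abel

omit [DecidableEq n] in
/-- The (unnormalized) Hilbert–Schmidt norm as a trace: `Re Tr(AᴴA) = Σ_{i,j} |A_{ij}|²`. [folklore] -/
private theorem trace_conjTranspose_mul_self_re (A : Matrix n n ℂ) :
    ((Aᴴ * A).trace).re = ∑ i, ∑ j, ‖A i j‖ ^ 2 := by
  rw [Finset.sum_comm]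
  simp only [Matrix.trace, Matrix.diag, Matrix.mul_apply, Matrix.conjTranspose_apply, Complex.re_sum,
    RCLike.star_def, Complex.conj_mul', ← Complex.ofReal_pow, Complex.ofReal_re]

/-- **(11)** p. 258 [4], middle equality, unnormalized form: for `U ∈ U(N)`,
`Re Tr((U − 1)ᴴ(U − 1)) = 2(N − Re Tr U)`, i.e. `N − Re Tr U = ½‖U − 1‖²_HS`.  Kernel-checked matrix algebra.
[cite: Balaban1985UV3, (11) p.258] -/
theorem re_trace_defect_eq (U : Matrix n n ℂ) (hU : U ∈ Matrix.unitaryGroup n ℂ) :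
    (((U - 1)ᴴ * (U - 1)).trace).re = 2 * ((Fintype.card n : ℝ) - U.trace.re) := by
  rw [conjTranspose_sub_one_mul_self U hU, trace_sub, trace_sub, trace_smul, trace_one, trace_conjTranspose,
    Complex.sub_re, Complex.sub_re, RCLike.star_def, Complex.conj_re, smul_eq_mul, Complex.mul_re]
  simp only [Complex.re_ofNat, Complex.im_ofNat, Complex.natCast_re, Complex.natCast_im, mul_zero, sub_zero]
  ring

/-- **(11)** p. 258 [4], middle equality as printed, verbatim context: *"exp[−(1/g₀²)[1 − Re tr U(∂p)]] =
exp[−(1/2g₀²)|U(∂p) − 1|²]"*, i.e. `1 − Re tr U = ½|U − 1|²`, in the reading under which it is an identity for every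
`U ∈ U(N)`, `N ≥ 1`: `tr = N⁻¹Tr` the normalized trace (`tr 1 = 1`, the convention of the series, cf.
`Setup.GaugeGroup.reTr_one`) and `|A|² = N⁻¹Σ_{i,j}|A_{ij}|²` the normalized Hilbert–Schmidt norm.  (With the
operator norm of [Balaban1985Averaging] (19) the middle member of (11) is an inequality with a dimension-dependent
constant — cell DIVERGENCE D-b10.1, recorded in `…B10`; not asserted here.)  Kernel-checked. [cite: Balaban1985UV3, (11) p.258] -/
theorem eq11_normalized [Nonempty n] (U : Matrix n n ℂ) (hU : U ∈ Matrix.unitaryGroup n ℂ) :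
    1 - (Fintype.card n : ℝ)⁻¹ * U.trace.re =
      (1 / 2) * ((Fintype.card n : ℝ)⁻¹ * ∑ i, ∑ j, ‖(U - 1) i j‖ ^ 2) := by
  rw [← trace_conjTranspose_mul_self_re, re_trace_defect_eq U hU]
  have hN : (Fintype.card n : ℝ) ≠ 0 := Nat.cast_ne_zero.mpr Fintype.card_ne_zero
  have hN' : (Fintype.card n : ℝ)⁻¹ * (Fintype.card n : ℝ) = 1 := inv_mul_cancel₀ hN
  linear_combination (-1 : ℝ) * hN'

section OperatorNorm

/-!
### v1.1 (append-only, same unit): the operator-norm reading of (11)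

With `|U(∂p) − 1|` the OPERATOR norm ([Balaban1985Averaging] (19), `Setup.GaugeGroup.dist1`) the middle member of
(11) is not an identity but the inequality `1 − Re tr U ≥ (2N)⁻¹|U − 1|²` (`tr = N⁻¹Tr`), i.e.
`|U − 1|²_op ≤ 2N(1 − Re tr U) = ‖U − 1‖²_HS` — the *"harmless constant"* `(2 dim)⁻¹` recorded in the docstring of
`B10.smallFactor_le_pow` (cell DIVERGENCE D-b10.1).  Kernel-checked here in two forms: vector form
(`eq11_opNorm_vector`, for every `v : n → ℂ`) and norm form (`eq11_opNorm`, in Mathlib's `L2Operator` matrix norm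
`Matrix.instL2OpNormedAddCommGroup`, scoped).  The only ingredient beyond `re_trace_defect_eq` is that the
Hilbert–Schmidt norm dominates the operator norm (Cauchy–Schwarz per row).
-/

omit [DecidableEq n] in
/-- Hilbert–Schmidt dominates the operator norm, vector form: `Σ_i |(Av)_i|² ≤ (Σ_{i,j}|A_{ij}|²)·Σ_j|v_j|²`
(Cauchy–Schwarz in each row). [folklore] -/
private theorem sum_norm_mulVec_sq_le (A : Matrix n n ℂ) (v : n → ℂ) :
    ∑ i, ‖(A *ᵥ v) i‖ ^ 2 ≤ (∑ i, ∑ j, ‖A i j‖ ^ 2) * ∑ j, ‖v j‖ ^ 2 := by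
  rw [Finset.sum_mul]
  refine Finset.sum_le_sum fun i _ => ?_
  have h1 : ‖(A *ᵥ v) i‖ ≤ ∑ j, ‖A i j‖ * ‖v j‖ := by
    rw [Matrix.mulVec, dotProduct]
    exact (norm_sum_le _ _).trans (le_of_eq (Finset.sum_congr rfl fun j _ => norm_mul _ _))
  have h2 : ∑ j, ‖A i j‖ * ‖v j‖ ≤ √(∑ j, ‖A i j‖ ^ 2) * √(∑ j, ‖v j‖ ^ 2) :=
    Real.sum_mul_le_sqrt_mul_sqrt _ _ _
  have hA : 0 ≤ ∑ j, ‖A i j‖ ^ 2 := Finset.sum_nonneg fun j _ => sq_nonneg _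
  have hv : 0 ≤ ∑ j, ‖v j‖ ^ 2 := Finset.sum_nonneg fun j _ => sq_nonneg _
  calc ‖(A *ᵥ v) i‖ ^ 2 ≤ (√(∑ j, ‖A i j‖ ^ 2) * √(∑ j, ‖v j‖ ^ 2)) ^ 2 :=
        pow_le_pow_left₀ (norm_nonneg _) (h1.trans h2) 2
    _ = (∑ j, ‖A i j‖ ^ 2) * ∑ j, ‖v j‖ ^ 2 := by
        rw [mul_pow, Real.sq_sqrt hA, Real.sq_sqrt hv]

/-- The Hilbert–Schmidt side of **(11)** p. 258 [4] for `U ∈ U(N)`, `N ≥ 1`: `Σ_{i,j}|(U − 1)_{ij}|² = 2N(1 − Re tr U)`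
(`tr = N⁻¹Tr`), i.e. `eq11_normalized` cleared of denominators. Kernel-checked. [cite: Balaban1985UV3, (11) p.258] -/
theorem sum_sq_entries_eq [Nonempty n] (U : Matrix n n ℂ) (hU : U ∈ Matrix.unitaryGroup n ℂ) :
    ∑ i, ∑ j, ‖(U - 1) i j‖ ^ 2 =
      2 * (Fintype.card n : ℝ) * (1 - (Fintype.card n : ℝ)⁻¹ * U.trace.re) := by
  have hN : (Fintype.card n : ℝ) ≠ 0 := Nat.cast_ne_zero.mpr Fintype.card_ne_zero
  rw [← trace_conjTranspose_mul_self_re, re_trace_defect_eq U hU]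
  field_simp

/-- **(11)** p. 258 [4], middle member in the OPERATOR-NORM reading of `|U(∂p) − 1|` ([Balaban1985Averaging] (19)),
vector form: for `U ∈ U(N)` and every `v`, `‖(U − 1)v‖² ≤ 2N(1 − Re tr U)·‖v‖²` (`tr = N⁻¹Tr`), i.e.
`1 − Re tr U ≥ (2N)⁻¹|U − 1|²_op` — the inequality (with its dimension-dependent constant) that replaces the printed
equality under this reading (cell DIVERGENCE D-b10.1; docstring of `B10.smallFactor_le_pow`).  Kernel-checked from
`sum_sq_entries_eq` and Hilbert–Schmidt ≥ operator norm. [cite: Balaban1985UV3, (11) p.258] -/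
theorem eq11_opNorm_vector [Nonempty n] (U : Matrix n n ℂ) (hU : U ∈ Matrix.unitaryGroup n ℂ) (v : n → ℂ) :
    ∑ i, ‖((U - 1) *ᵥ v) i‖ ^ 2 ≤
      (2 * (Fintype.card n : ℝ) * (1 - (Fintype.card n : ℝ)⁻¹ * U.trace.re)) * ∑ j, ‖v j‖ ^ 2 := by
  rw [← sum_sq_entries_eq U hU]
  exact sum_norm_mulVec_sq_le (U - 1) v

open scoped Matrix.Norms.L2Operator in
/-- **(11)** p. 258 [4], middle member in the OPERATOR-NORM reading, norm form: for `U ∈ U(N)`,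
`‖U − 1‖²_op ≤ 2N(1 − Re tr U)` (`tr = N⁻¹Tr`; `‖·‖` = Mathlib's `L2Operator` norm on `Matrix n n ℂ`, the operator
norm on Euclidean `ℂⁿ`, = the `|·|` of [Balaban1985Averaging] (19)), equivalently `1 − Re tr U ≥ (2N)⁻¹‖U − 1‖²_op`.
Kernel-checked (`eq11_opNorm_vector` + `ContinuousLinearMap.opNorm_le_bound`). [cite: Balaban1985UV3, (11) p.258] -/
theorem eq11_opNorm [Nonempty n] (U : Matrix n n ℂ) (hU : U ∈ Matrix.unitaryGroup n ℂ) :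
    ‖U - 1‖ ^ 2 ≤ 2 * (Fintype.card n : ℝ) * (1 - (Fintype.card n : ℝ)⁻¹ * U.trace.re) := by
  set S : ℝ := 2 * (Fintype.card n : ℝ) * (1 - (Fintype.card n : ℝ)⁻¹ * U.trace.re) with hS
  have hSeq : ∑ i, ∑ j, ‖(U - 1) i j‖ ^ 2 = S := sum_sq_entries_eq U hU
  have hS0 : 0 ≤ S :=
    hSeq ▸ Finset.sum_nonneg fun i _ => Finset.sum_nonneg fun j _ => sq_nonneg _
  have hbound : ∀ x : EuclideanSpace ℂ n,
      ‖toEuclideanCLM (n := n) (𝕜 := ℂ) (U - 1) x‖ ≤ √S * ‖x‖ := by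
    intro x
    have hx0 : 0 ≤ √S * ‖x‖ := by positivity
    refine (pow_le_pow_iff_left₀ (norm_nonneg _) hx0 two_ne_zero).mp ?_
    rw [EuclideanSpace.norm_sq_eq, mul_pow, Real.sq_sqrt hS0, EuclideanSpace.norm_sq_eq, ← hSeq]
    exact sum_norm_mulVec_sq_le (U - 1) (WithLp.ofLp x)
  have h := ContinuousLinearMap.opNorm_le_bound _ (Real.sqrt_nonneg S) hbound
  rw [← cstar_norm_def] at h
  calc ‖U - 1‖ ^ 2 ≤ (√S) ^ 2 := pow_le_pow_left₀ (norm_nonneg _) h 2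
    _ = S := Real.sq_sqrt hS0

end OperatorNorm

end Literature.MathematicalPhysics.QuantumFieldTheory.Balaban1983to89.B10Eq11Trace
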